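import Mathlib
import Summits.Ventures.HodgeRepro.Tier4.Common.LocalCoordinatesConj
import Summits.Ventures.HodgeRepro.Tier4.Line4.D3CoeffDecayConj

/-!
# Tier4/Line4/LocEntryLeSize — the REVERSE entry bound: every complex coordinate `locEntry(') x I J` at `w` is bounded
by the `ℓ¹` size `∑ᵢⱼ ‖adToC w (mat x i j)‖` (plan-4's `archSizeAt W w x`), on the row planes and on the seesaw plane

Blind re-derivation cell `pub-hodge-repro`, Tier 4 (README §9–§10), seat t4-L1-p5 (prover, gen 4; companion of
C-L4-D3DECAY p701467 / p701824, offered to L1-p3 g4's `OrbitInvariant` (lead (R-27) S15050: «`|I|_w ≤ c · archSizeAt_w²`»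
with `I(γ) = N_{E/k}(ℓ₀₀ γ)`, `|ℓ₀₀|_w ≤ c · archSizeAt_w` being this module)).  Target tree path
`lean/Summits/Ventures/HodgeRepro/Tier4/Line4/LocEntryLeSize.lean`.  On typer-2's `locEntry_eq_blockWeight`
(`locEntry g I J = adToC w (M i j) + adToC w (M i' j) · wroot q w`) and D3CoeffDecayConj's `sum_norm_adToC_mul_le`;
no printed input.

WHAT IS PROVED.
* `norm_locEntry_le_sum` — on a row plane, `‖locEntry q a b ε w g I J‖ ≤ (1 + ‖wroot q w‖) · ∑ᵢⱼ ‖adToC w (mat g i j)‖`;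
* `sum_norm_adToC_mat_conjTo_le` — on the seesaw plane, `∑ᵢⱼ ‖adToC w (mat (g′ x g) i j)‖ ≤ ‖adMat g′‖₁ ‖adMat g‖₁ ·
  ∑ᵢⱼ ‖adToC w (mat x i j)‖` (`mat_conjTo` and the sub-multiplicativity);
* **`norm_locEntry'_le_sum`** — `‖locEntry' x I J‖ ≤ (1 + ‖wroot q w‖) · ‖adMat g′‖₁ ‖adMat g‖₁ · ∑ᵢⱼ ‖adToC w (mat x i j)‖`.
With D3CoeffDecayConj's `sum_norm_adToC_mat_le'` (`archSizeAt W w x ≤ c_g ‖locEntry' x 0 0‖`) the size at `w` and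
`|α′(x)| = |locEntry' x 0 0|` are COMPARABLE on the seesaw plane (two-sided, constants of `(q, a, g, g′)` at `w`).

Nothing here says anything about the status of the Hodge conjecture for CM abelian varieties, which is NOT proved
(HC_CM is NOT proved by anyone in this repository).
-/

set_option autoImplicit false

noncomputable section

namespace Summit.Ventures.HodgeRepro.Tier4.Line4

open Summit.Ventures.HodgeRepro.Tier4.Common NumberField Matrix

section Row

variable {k : Type} [Field k] [NumberField k] (q : QuadData k) (a b ε : k) (w : InfinitePlace k)

/-- every entry norm is at most the `ℓ¹` size. -/
theorem norm_adToC_entry_le_sum (M : Matrix (Fin 4) (Fin 4) (Ad k)) (i j : Fin 4) :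
    ‖adToC w (M i j)‖ ≤ ∑ i' : Fin 4, ∑ j' : Fin 4, ‖adToC w (M i' j')‖ := by
  calc ‖adToC w (M i j)‖ ≤ ∑ j' : Fin 4, ‖adToC w (M i j')‖ :=
        Finset.single_le_sum (f := fun j' : Fin 4 => ‖adToC w (M i j')‖) (fun _ _ => norm_nonneg _)
          (Finset.mem_univ j)
    _ ≤ ∑ i' : Fin 4, ∑ j' : Fin 4, ‖adToC w (M i' j')‖ :=
        Finset.single_le_sum (f := fun i' : Fin 4 => ∑ j' : Fin 4, ‖adToC w (M i' j')‖)
          (fun _ _ => Finset.sum_nonneg fun _ _ => norm_nonneg _) (Finset.mem_univ i)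

/-- **the reverse entry bound on a row plane**: `‖locEntry g I J‖ ≤ (1 + ‖wroot q w‖) · ∑ᵢⱼ ‖adToC w (mat g i j)‖`
(`locEntry g I J = adToC w (M i j) + adToC w (M i′ j) · wroot q w`). -/
theorem norm_locEntry_le_sum (g : GA (PlaneData.ofLinesRow q a b ε)) (I J : Fin 2) :
    ‖locEntry q a b ε w g I J‖ ≤
      (1 + ‖wroot q w‖) * ∑ i : Fin 4, ∑ j : Fin 4, ‖adToC w (GA.mat (PlaneData.ofLinesRow q a b ε) g i j)‖ := by
  set M := GA.mat (PlaneData.ofLinesRow q a b ε) g with hM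
  set S := ∑ i : Fin 4, ∑ j : Fin 4, ‖adToC w (M i j)‖ with hS
  have hω : 0 ≤ ‖wroot q w‖ := norm_nonneg _
  rw [locEntry_eq_blockWeight, blocksOf_apply_zero_zero, blocksOf_apply_one_zero]
  unfold blockWeight
  calc ‖adToC w (M (lineBase I) (lineBase J)) + adToC w (M (lineOmega I) (lineBase J)) * wroot q w‖
      ≤ ‖adToC w (M (lineBase I) (lineBase J))‖ + ‖adToC w (M (lineOmega I) (lineBase J))‖ * ‖wroot q w‖ := by
        exact (norm_add_le _ _).trans (add_le_add le_rfl (norm_mul_le _ _))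
    _ ≤ S + S * ‖wroot q w‖ :=
        add_le_add (norm_adToC_entry_le_sum w M _ _)
          (mul_le_mul_of_nonneg_right (norm_adToC_entry_le_sum w M _ _) hω)
    _ = (1 + ‖wroot q w‖) * S := by ring

end Row

section Seesaw

variable {k : Type} [Field k] [NumberField k] (q : QuadData k) (a : Fin 4 → k)
  (g g' : Matrix (Fin 4) (Fin 4) k) (hgg' : g * g' = 1) (hg'g : g' * g = 1)
  (hgΩ : g * (PlaneData.mixedRow q (a 0) (a 2)).Ω = (PlaneData.mixedRow q (a 0) (a 2)).Ω * g)
  (lam : k) (hlam : lam ≠ 0)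
  (hiso : g * (PlaneData.mixedRow q (a 1) (a 3)).B * gᵀ = lam • (PlaneData.mixedRow q (a 0) (a 2)).B)
  (w : InfinitePlace k)

include hlam in
/-- the size of the conjugate `g′ x g` is at most `‖adMat g′‖₁ ‖adMat g‖₁` times the size of `x`. -/
theorem sum_norm_adToC_mat_conjTo_le
    (x : GA ((PlaneData.mixedRow q (a 0) (a 2)).withTransportedTorus g g' hgg' hg'g hgΩ)) :
    ∑ i : Fin 4, ∑ j : Fin 4,
        ‖adToC w (GA.mat (PlaneData.ofLinesRow q (a 1) (a 3) (-1)) (conjTo q a g g' hgg' hg'g hgΩ lam hiso x) i j)‖ ≤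
      (∑ i : Fin 4, ∑ j : Fin 4, ‖adToC w (adMat k g' i j)‖) * (∑ i : Fin 4, ∑ j : Fin 4, ‖adToC w (adMat k g i j)‖) *
        ∑ i : Fin 4, ∑ j : Fin 4,
          ‖adToC w (GA.mat ((PlaneData.mixedRow q (a 0) (a 2)).withTransportedTorus g g' hgg' hg'g hgΩ) x i j)‖ := by
  have _hlam := hlam
  rw [mat_conjTo]
  set M := GA.mat ((PlaneData.mixedRow q (a 0) (a 2)).withTransportedTorus g g' hgg' hg'g hgΩ) x with hM
  set Sg := ∑ i : Fin 4, ∑ j : Fin 4, ‖adToC w (adMat k g i j)‖ with hSg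
  set Sg' := ∑ i : Fin 4, ∑ j : Fin 4, ‖adToC w (adMat k g' i j)‖ with hSg'
  have hSg0 : 0 ≤ Sg := Finset.sum_nonneg fun _ _ => Finset.sum_nonneg fun _ _ => norm_nonneg _
  calc ∑ i : Fin 4, ∑ j : Fin 4, ‖adToC w ((adMat k g' * M * adMat k g) i j)‖
      ≤ (∑ i : Fin 4, ∑ j : Fin 4, ‖adToC w ((adMat k g' * M) i j)‖) * Sg := sum_norm_adToC_mul_le w _ _
    _ ≤ (Sg' * ∑ i : Fin 4, ∑ j : Fin 4, ‖adToC w (M i j)‖) * Sg :=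
        mul_le_mul_of_nonneg_right (sum_norm_adToC_mul_le w _ _) hSg0
    _ = Sg' * Sg * ∑ i : Fin 4, ∑ j : Fin 4, ‖adToC w (M i j)‖ := by ring

include hlam in
/-- **THE REVERSE ENTRY BOUND ON THE SEESAW PLANE**: `‖locEntry' x I J‖ ≤ (1 + ‖wroot q w‖) · ‖adMat g′‖₁ ‖adMat g‖₁ ·
∑ᵢⱼ ‖adToC w (mat x i j)‖` — in particular `|α′(x)| = |ℓ₀₀(x)|` is at most a constant times plan-4's `archSizeAt W w x`
(the input of L1-p3's `|I|_w ≤ c · archSizeAt_w²`, (R-27)). -/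
theorem norm_locEntry'_le_sum
    (x : GA ((PlaneData.mixedRow q (a 0) (a 2)).withTransportedTorus g g' hgg' hg'g hgΩ)) (I J : Fin 2) :
    ‖locEntry' q a g g' hgg' hg'g hgΩ lam hiso w x I J‖ ≤
      (1 + ‖wroot q w‖) *
        ((∑ i : Fin 4, ∑ j : Fin 4, ‖adToC w (adMat k g' i j)‖) * (∑ i : Fin 4, ∑ j : Fin 4, ‖adToC w (adMat k g i j)‖)) *
        ∑ i : Fin 4, ∑ j : Fin 4,
          ‖adToC w (GA.mat ((PlaneData.mixedRow q (a 0) (a 2)).withTransportedTorus g g' hgg' hg'g hgΩ) x i j)‖ := by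
  have hl : locEntry' q a g g' hgg' hg'g hgΩ lam hiso w x I J =
      locEntry q (a 1) (a 3) (-1) w (conjTo q a g g' hgg' hg'g hgΩ lam hiso x) I J := rfl
  rw [hl]
  have h1 := norm_locEntry_le_sum q (a 1) (a 3) (-1) w (conjTo q a g g' hgg' hg'g hgΩ lam hiso x) I J
  have h2 := sum_norm_adToC_mat_conjTo_le q a g g' hgg' hg'g hgΩ lam hlam hiso w x
  have hω : 0 ≤ 1 + ‖wroot q w‖ := by positivity
  calc ‖locEntry q (a 1) (a 3) (-1) w (conjTo q a g g' hgg' hg'g hgΩ lam hiso x) I J‖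
      ≤ (1 + ‖wroot q w‖) * ∑ i : Fin 4, ∑ j : Fin 4,
          ‖adToC w (GA.mat (PlaneData.ofLinesRow q (a 1) (a 3) (-1)) (conjTo q a g g' hgg' hg'g hgΩ lam hiso x) i j)‖ :=
        h1
    _ ≤ (1 + ‖wroot q w‖) *
          ((∑ i : Fin 4, ∑ j : Fin 4, ‖adToC w (adMat k g' i j)‖) * (∑ i : Fin 4, ∑ j : Fin 4, ‖adToC w (adMat k g i j)‖) *
            ∑ i : Fin 4, ∑ j : Fin 4,
              ‖adToC w (GA.mat ((PlaneData.mixedRow q (a 0) (a 2)).withTransportedTorus g g' hgg' hg'g hgΩ) x i j)‖) :=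
        mul_le_mul_of_nonneg_left h2 hω
    _ = _ := by ring

end Seesaw

end Summit.Ventures.HodgeRepro.Tier4.Line4

end
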